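import Mathlib
import Literature.Computability.AlgebraicComplexity.PermanentIrreducible
import Literature.Computability.AlgebraicComplexity.StandardFamiliesProofs
import Summits.ValiantsHypothesis.ValiantsHypothesis.Theorems.DivisionGapPerCofactorDegreeReductionStubAdditiveCreation
import Summits.ValiantsHypothesis.ValiantsHypothesis.Theorems.DivisionGapPerCofactorDegreeReductionStubAntipodalRatioRoot

/-!
# Crux `DivisionGap.PerCofactorDegreeReduction` (stmt-ValiantsHypothesis-15046), line `Sketch` —
# stub `stub_proportionalClassesCollapse`: proportional classes admit no nonnegative homogeneous
# relation unless some ratio is negative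

**Theorem (`stub_proportionalClassesCollapse`).** Let `n ≥ 1` and let `ℓ₀, …, ℓ_r ∈ ℝ≥0[x_ij]`
(`n × n` variables) with real images `Lᵢ := MvPolynomial.map NNReal.toRealHom ℓᵢ` not divisible by
`per_n` over `ℝ`.  Suppose the classes of the `Lᵢ` modulo `(per_n)` are real multiples of the class
of `L₀`: `per_n ∣ Lᵢ − μᵢ L₀` for reals `μᵢ`.  If `G ∈ ℝ≥0[y₀, …, y_r]` is nonzero, homogeneous of
degree `N`, and `per_n` divides the real image of `G(ℓ₀, …, ℓ_r)`, then `μᵢ < 0` for some `i`.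

## Proof

`P := per_n` is prime in `ℝ[x]` (`AdditiveCreation.perPoly_prime`).  Let `π` be the quotient map
by `(P)`; then `π Lᵢ = π (C μᵢ) · π L₀`.  The composite ring hom
`ψ := π ∘ map toRealHom ∘ aeval ℓ : ℝ≥0[y] → ℝ[x]/(P)` sends `yᵢ ↦ π (C μᵢ) · π L₀` and
`C c ↦ π (C c)`.  Expanding `G = Σ_m coeff_m · y^m` over its support and using homogeneity
(`Σᵢ mᵢ = N` on the support), `ψ G = π (C s) · (π L₀)^N` with
`s := Σ_m coeff_m · ∏ᵢ μᵢ^{mᵢ}`.  The hypothesis says `ψ G = 0`, so `P ∣ C s · L₀^N`; `P` is prime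
and `P ∤ L₀`, hence `P ∤ L₀^N`, so `P ∣ C s` and `s = 0` (a prime divides no nonzero constant,
`AntipodalRatioRoot.eq_zero_of_prime_dvd_C`).  Every `μᵢ ≠ 0` (else `P ∣ Lᵢ`).  If all `μᵢ ≥ 0`
then all `μᵢ > 0`, every term of `s` is `> 0` and the support of `G ≠ 0` is nonempty, so `s > 0`,
a contradiction.

Leans on the tree only: `AdditiveCreation.perPoly_prime`, `AntipodalRatioRoot.eq_zero_of_prime_dvd_C`;
Mathlib.  No definitions.
-/

noncomputable section

-- `Summit.ValiantsHypothesis.ValiantsHypothesis.…` is the tree's mandated single-conjunct layout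
-- (Problem = Summit), so the duplicated namespace component is intended.
set_option linter.dupNamespace false

namespace Summit.ValiantsHypothesis.ValiantsHypothesis.Theorems.DivisionGap.PerCofactorDegreeReduction.ProportionalClassesCollapse

open MvPolynomial Literature.Computability.AlgebraicComplexity
open scoped NNReal BigOperators

/-- A ring hom out of a polynomial ring in finitely many variables, evaluated termwise over the
support: `ψ G = Σ_{m ∈ supp G} ψ (C (coeff m G)) · ∏ᵢ ψ (X i)^{m i}`. [folklore] -/
theorem ringHom_apply_eq_sum {σ R S : Type*} [Fintype σ] [CommSemiring R] [CommSemiring S]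
    (ψ : MvPolynomial σ R →+* S) (G : MvPolynomial σ R) :
    ψ G = ∑ m ∈ G.support, ψ (C (coeff m G)) * ∏ i, ψ (X i) ^ (m i) := by
  conv_lhs => rw [G.as_sum, map_sum]
  refine Finset.sum_congr rfl fun m _ => ?_
  rw [monomial_eq, Finsupp.prod_pow, map_mul, map_prod]
  simp only [map_pow]

/-- Monomials in the support of a polynomial homogeneous of degree `N` have exponent sum `N`.
[folklore] -/
theorem sum_eq_of_mem_support {σ R : Type*} [Fintype σ] [CommSemiring R]
    {G : MvPolynomial σ R} {N : ℕ} (hG : G.IsHomogeneous N) {m : σ →₀ ℕ}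
    (hm : m ∈ G.support) : ∑ i, m i = N := by
  rw [← Finsupp.degree_eq_sum]
  by_contra h
  exact (mem_support_iff.mp hm) (hG.coeff_eq_zero h)

/-- **Substitution of proportional values into a homogeneous polynomial.**  If a ring hom `ψ` out
of `R[y]` sends `yᵢ ↦ cᵢ · u` and `G` is homogeneous of degree `N`, then
`ψ G = (Σ_{m ∈ supp G} ψ (C (coeff m G)) · ∏ᵢ cᵢ^{mᵢ}) · u^N`. [folklore] -/
theorem ringHom_apply_eq_of_proportional {σ R S : Type*} [Fintype σ] [CommSemiring R]
    [CommSemiring S] (ψ : MvPolynomial σ R →+* S) {G : MvPolynomial σ R} {N : ℕ}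
    (hG : G.IsHomogeneous N) (c : σ → S) (u : S) (hX : ∀ i, ψ (X i) = c i * u) :
    ψ G = (∑ m ∈ G.support, ψ (C (coeff m G)) * ∏ i, c i ^ (m i)) * u ^ N := by
  rw [ringHom_apply_eq_sum, Finset.sum_mul]
  refine Finset.sum_congr rfl fun m hm => ?_
  simp_rw [hX, mul_pow, Finset.prod_mul_distrib, Finset.prod_pow_eq_pow_sum,
    sum_eq_of_mem_support hG hm, mul_assoc]

/-- **stub_proportionalClassesCollapse — PROPORTIONAL CLASSES COLLAPSE.**  If the real images
`Lᵢ` of nonnegative gates `ℓ₀, …, ℓ_r` (`n ≥ 1`, `per_n ∤ Lᵢ`) satisfy `per_n ∣ Lᵢ − μᵢ L₀` for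
reals `μᵢ`, and `per_n` divides the real image of `G(ℓ)` for a nonzero nonnegative `G` homogeneous
of degree `N`, then some `μᵢ < 0`.  Proof: modulo `per_n`, `G(ℓ) ≡ G(μ) · L₀^N`; `per_n` is prime
and divides neither `L₀^N` nor a nonzero constant, so `G(μ) = 0`; all `μᵢ ≠ 0` (else
`per_n ∣ Lᵢ`), and `G(μ) > 0` if all `μᵢ > 0`. [folklore] -/
theorem stub_proportionalClassesCollapse (n r N : ℕ) (hn : 1 ≤ n)
    (ℓ : Fin (r + 1) → MvPolynomial (Fin n × Fin n) ℝ≥0)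
    (hℓ : ∀ i, ¬ perPoly (Fin n) ℝ ∣ MvPolynomial.map NNReal.toRealHom (ℓ i))
    (μ : Fin (r + 1) → ℝ)
    (hμ : ∀ i, perPoly (Fin n) ℝ ∣ MvPolynomial.map NNReal.toRealHom (ℓ i) -
      C (μ i) * MvPolynomial.map NNReal.toRealHom (ℓ 0))
    (G : MvPolynomial (Fin (r + 1)) ℝ≥0) (hG : G ≠ 0) (hGh : G.IsHomogeneous N)
    (hdvd : perPoly (Fin n) ℝ ∣ MvPolynomial.map NNReal.toRealHom (MvPolynomial.aeval ℓ G)) :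
    ∃ i, μ i < 0 := by
  have hprime : Prime (perPoly (Fin n) ℝ) := AdditiveCreation.perPoly_prime hn
  set P := perPoly (Fin n) ℝ with hPdef
  -- the quotient map by `(P)`
  set π := Ideal.Quotient.mk (Ideal.span ({P} : Set (MvPolynomial (Fin n × Fin n) ℝ))) with hπdef
  have hπ0 : ∀ a, π a = 0 ↔ P ∣ a := fun a => by
    rw [hπdef, Ideal.Quotient.eq_zero_iff_mem, Ideal.mem_span_singleton]
  -- `π Lᵢ = π (C μᵢ) · π L₀`
  have hL : ∀ i, π (MvPolynomial.map NNReal.toRealHom (ℓ i)) =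
      π (C (μ i)) * π (MvPolynomial.map NNReal.toRealHom (ℓ 0)) := fun i => by
    have h2 : π (MvPolynomial.map NNReal.toRealHom (ℓ i)) -
        π (C (μ i)) * π (MvPolynomial.map NNReal.toRealHom (ℓ 0)) = 0 := by
      rw [← map_mul, ← map_sub]
      exact (hπ0 _).2 (hμ i)
    exact sub_eq_zero.mp h2
  -- the composite ring hom `ψ = π ∘ map toRealHom ∘ aeval ℓ`
  set ψ : MvPolynomial (Fin (r + 1)) ℝ≥0 →+* MvPolynomial (Fin n × Fin n) ℝ ⧸
      Ideal.span ({P} : Set (MvPolynomial (Fin n × Fin n) ℝ)) :=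
    π.comp ((MvPolynomial.map NNReal.toRealHom).comp
      (MvPolynomial.aeval ℓ : MvPolynomial (Fin (r + 1)) ℝ≥0 →ₐ[ℝ≥0]
        MvPolynomial (Fin n × Fin n) ℝ≥0).toRingHom) with hψdef
  have hψX : ∀ i, ψ (X i) = π (C (μ i)) * π (MvPolynomial.map NNReal.toRealHom (ℓ 0)) :=
    fun i => by
    rw [← hL i]
    show π (MvPolynomial.map NNReal.toRealHom (MvPolynomial.aeval ℓ (X i))) = _
    rw [aeval_X]
  have hψC : ∀ c : ℝ≥0, ψ (C c) = π (C (c : ℝ)) := fun c => by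
    show π (MvPolynomial.map NNReal.toRealHom (MvPolynomial.aeval ℓ (C c))) = _
    rw [aeval_C, algebraMap_eq, map_C, NNReal.coe_toRealHom]
  -- `ψ G = π (C s) · (π L₀)^N` with `s = G(μ)`
  set s : ℝ := ∑ m ∈ G.support, ((coeff m G : ℝ≥0) : ℝ) * ∏ i, μ i ^ (m i) with hsdef
  have hψG : ψ G = π (C s) * π (MvPolynomial.map NNReal.toRealHom (ℓ 0)) ^ N := by
    rw [ringHom_apply_eq_of_proportional ψ hGh (fun i => π (C (μ i))) _ hψX]
    congr 1
    rw [hsdef, map_sum C, map_sum π]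
    refine Finset.sum_congr rfl fun m _ => ?_
    simp only [hψC, map_mul, map_prod, map_pow]
  -- hence `P ∣ C s · L₀^N`
  have h3 : P ∣ C s * MvPolynomial.map NNReal.toRealHom (ℓ 0) ^ N := by
    rw [← hπ0, map_mul, map_pow, ← hψG]
    show π (MvPolynomial.map NNReal.toRealHom (MvPolynomial.aeval ℓ G)) = 0
    exact (hπ0 _).2 hdvd
  -- primality: `s = 0`
  have hs : s = 0 := by
    rcases hprime.dvd_or_dvd h3 with h4 | h4
    · exact AntipodalRatioRoot.eq_zero_of_prime_dvd_C hprime h4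
    · exact absurd (hprime.dvd_of_dvd_pow h4) (hℓ 0)
  -- every ratio is nonzero
  have hμne : ∀ i, μ i ≠ 0 := fun i hi => by
    have h5 := hμ i
    rw [hi, C_0, zero_mul, sub_zero] at h5
    exact hℓ i h5
  -- if all ratios were nonnegative, `s > 0`
  by_contra hneg
  push Not at hneg
  have hpos : ∀ i, 0 < μ i := fun i => lt_of_le_of_ne (hneg i) (hμne i).symm
  have hs_pos : 0 < s := by
    apply Finset.sum_pos
    · intro m hm
      have hc : (0 : ℝ) < ((coeff m G : ℝ≥0) : ℝ) :=
        NNReal.coe_pos.mpr (pos_iff_ne_zero.mpr (mem_support_iff.mp hm))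
      exact mul_pos hc (Finset.prod_pos fun i _ => pow_pos (hpos i) _)
    · exact support_nonempty.mpr hG
  exact hs_pos.ne' hs

end Summit.ValiantsHypothesis.ValiantsHypothesis.Theorems.DivisionGap.PerCofactorDegreeReduction.ProportionalClassesCollapse

end
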